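import Summits.BirchSwinnertonDyer.BirchSwinnertonDyer.Theorems.EisensteinPrimesResidualDevissageSplitLocalData
import Summits.BirchSwinnertonDyer.BirchSwinnertonDyer.Theorems.EisensteinPrimesResidualIndexHZero
import Summits.BirchSwinnertonDyer.BirchSwinnertonDyer.Theorems.EisensteinPrimesBSDpOnCellCCtlLocFinV
import HarnessLib

/-!
# Crux 4 `BSDpOnCellC` (stmt-BirchSwinnertonDyer-19034), line b1 — the SPLIT conjunct of the wall `stub_imprimitiveCount`:
# the LOCAL `H⁰` PACKAGE AT A SPLIT MULTIPLICATIVE `v̄` for the x1 cell's V21 index road, at the orientation (ω, 𝟙)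
# («the residual line is the Tate line at `v̄`»)

Cell `bsd-eis` (run/shared/lean/pub/bsd-eis/), width seat `bsd-line-x2-p2` gen 10 (`--supports -19034`, closes nothing; skeleton of
record b1 v12 sha256 155e218d… UNCHANGED, W-79).

WHY. The x1 cell proved Keller–Yin's anomalous λ-identity (Thm. 1.4.1 (iii), Cases I–III) for the GOOD anomalous lattice along the
V21 INDEX ROAD (`Cruxes/GoodLatticeBDPValue/Lines/halves-imprimLambda-index-road.md`; mid-level composition
`ResidualIndexAssembly.zpCorank_datumStrictSelmer_add_eq`, p645893, fed by the 35-conjunct package `stub_indexInputs`). That road is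
reduction-type free EXCEPT for three local `H⁰` inputs at `v̄`, which x1 derived from `Anom W p` (good, `a_p ≡ 1`) and «no unramified
rational line» (`AnomalousLocalTorsion.forall_inf_decomp_smul_quot_eq_self`, `sub_eq_zero_of_forall_inf_decomp_smul_eq`,
`finite_fixed_geomPrimaryTorsion_inf_decomp`, packaged in `ResidualIndexHZero.hZero_package`). At a SPLIT multiplicative Eisenstein prime the
residual pair is anomalous at `v̄` too (g9: `ResidualDevissageSplitLocalData.localData_of_split`, p670160 — `(θsub, θquot)|_{D_v̄} ∈
{(𝟙, ω), (ω, 𝟙)}`), so the split conjunct of line b1's wall needs the same road. THIS FILE supplies its three local inputs and the whole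
thirteen-conjunct `H⁰` package AT x1's EXACT TYPES for a split multiplicative datum at the orientation (ω, 𝟙) — `θsub` non-trivial on
`D_v̄`, i.e. the line `Φ` is the Tate line `μ_p` at `v̄` (Greenberg–Vatsal §2) —, so that the x1 producers downstream can be re-used
verbatim:

* §1 `trivQuot_and_cycSub_of_exists_unitChar_ne_one` — at a split datum, for a `Γ_K`-stable line `Φ ≤ E_K[p]` with `#Φ = p` embedded
  equivariantly in `(F/𝒪)(θsub)`, IF some `τ ∈ D_v̄` has `θsub(τ) ≠ 1` THEN `D_v̄` acts on `Φ` through `ω` and TRIVIALLY on `E_K[p]/Φ`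
  (g9's dichotomy, the branch «`D_v̄` fixes `Φ`» being excluded by `eq_zero_of_smul_eq_of_hom`);
* §2 the three local conjuncts: `forall_inf_decomp_smul_quot_eq_self_of_split` (`htrivD`), `sub_eq_zero_of_forall_inf_decomp_smul_eq_of_split`
  (`hN₁D`: `Φ^{ker κ ⊓ D_v̄} = 0`, `p`-power descent `AnomalousLocalTorsion.eq_zero_of_mem_line_of_fixed` from the mover `τ`),
  `finite_fixed_geomPrimaryTorsion_inf_decomp_of_split` (Fin_v at a SPLIT multiplicative prime — k5-c4's
  `CtlLoc.localTowerTorsionFiniteAt_of_hasSplitMultiplicativeReductionAtPrime`, Tate curve + the norm residue symbol of `π²/p^h`, read in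
  the subtype currency);
* §3 `hZero_package_of_split` — the thirteen «global H⁰» / «local H⁰ at `H ⊓ D_v̄`» conjuncts of x1's `stub_indexInputs` in x1's ORDER
  AND TYPES (the ten reduction-free ones by x1's own producers `ResidualIndexHZero.*`), and `exists_stableLine_hZero_package_of_split`
  (the package from the residual pair alone, with both Kummer embeddings, as x1's `exists_stableLine_hZero_package`).

Binders: `W/ℚ` globally minimal, `p ≠ 2` a SPLIT multiplicative prime, `K` imaginary quadratic with `(p)` split, `v̄ ∋ p`, `κ`
anticyclotomic, `E(K)[p] = 0`, `(θsub, θquot)` a residual pair of `E_K[p]` with `θsub` NON-TRIVIAL ON `D_v̄` (orientation (ω, 𝟙)). The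
other orientation (𝟙, ω) is the (ω, 𝟙) orientation of the `p`-isogenous curve `E/Φ` and is NOT treated here.

HONEST FRAMING: helper theorems only (0 defs, 0 named facts, 0 sorry); UNCONDITIONAL; closes no stub; no summit statement / BSD / MC /
IMC / KY Thm. 1.4.1 (iii) is proved for any curve; 0 cells / labels / tiers move.

References: [KellerYin2024] §1.3 Prop. 1.3.3 (iii), §1.4 Thm. 1.4.1 and Cases I–III, §5.1 (arXiv:2402.12781v2); [GreenbergVatsal2000] §2
pp. 14–15; [JetchevSkinnerWan2017] Prop. 3.3.4 Case 3(b); [GreenbergLNM1716] §4 p. 109; the x1 road memo (LEAD x1-p1 g4).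
-/

set_option autoImplicit false
-- the route's Theorems namespace repeats the summit name by design (D-0017 nested layout)
set_option linter.dupNamespace false

noncomputable section

open scoped Classical

namespace Summit.BirchSwinnertonDyer.BirchSwinnertonDyer.Theorems.SplitMultLocalHZero

open NumberField IsDedekindDomain Field WeierstrassCurve
  Literature.NumberTheory.EllipticCurves Literature.NumberTheory.EllipticCurves.GreenbergSelmer
  Literature.NumberTheory.EllipticCurves.Rank1Residual Literature.NumberTheory.GaloisRepresentations
  Literature.NumberTheory.EllipticCurves.KellerYin2024 Literature.NumberTheory.IwasawaTheory
  Summit.BirchSwinnertonDyer.Rank1Residual.X2.ResidualDevissageModules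
  Summit.BirchSwinnertonDyer.Rank1Residual.X11b
  Summit.BirchSwinnertonDyer.BirchSwinnertonDyer.Theorems
  Summit.BirchSwinnertonDyer.BirchSwinnertonDyer.Theorems.CharResidualSelmerCount
  Summit.BirchSwinnertonDyer.BirchSwinnertonDyer.Theorems.SchneiderFreeControlAtoms

/-! ## §1. Orientation (ω, 𝟙): `θsub` non-trivial on `D_v̄` forces `D_v̄` trivial on `E_K[p]/Φ` -/

section Orientation

variable {p : ℕ} [hp : Fact p.Prime] (W : WeierstrassCurve ℚ) [W.IsElliptic] [W.IsGloballyMinimal]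
  (K : Type) [Field K] [NumberField K] (vbar : HeightOneSpectrum (𝓞 K))

omit [W.IsElliptic] [W.IsGloballyMinimal] in
/-- **A line on which some `τ ∈ D_v̄` has `θsub(τ) ≠ 1` is not fixed pointwise by `D_v̄`**: for a non-zero stable line `Φ` of
`E_K[p]` (`#Φ = p`) with an equivariant embedding `j₁ : Φ ↪ (F/𝒪)(θsub)` (`θsub^{p−1} = 1`), a `τ ∈ D_v̄` with
`unitChar θsub τ ≠ 1` moves some point of `Φ` (`eq_zero_of_smul_eq_of_hom`: such a `τ` fixes only `0`).
[cite: KellerYin2024, §1.3 (arXiv:2402.12781v2 TeX L1040–1044)] -/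
theorem exists_smul_ne_of_exists_unitChar_ne_one
    (θsub : FramedGaloisRep K (padicCoeffIntegers (∅ : Set (PadicAlgCl p))) 1)
    (hθsub : ∀ σ : absoluteGaloisGroup K, θsub σ ^ (p - 1) = 1)
    (Φ : StableSubgroup (absoluteGaloisGroup K) ↥((W.baseChange K).geomTorsion (p : ℤ)))
    (hSub : Nat.card Φ.Sub = p) (j₁ : Φ.Sub →+ charModule (∅ : Set (PadicAlgCl p)) θsub)
    (hj₁ : ∀ (g : absoluteGaloisGroup K) (a : Φ.Sub), j₁ (g • a) = g • j₁ a) (hj₁inj : Function.Injective j₁)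
    (hram : ∃ τ ∈ decomp vbar, unitChar θsub τ ≠ 1) :
    ∃ τ ∈ decomp vbar, ∃ x : Φ.Sub, τ • x ≠ x := by
  obtain ⟨τ, hτ, hne⟩ := hram
  -- a non-zero point of the line
  haveI : Finite Φ.Sub := Nat.finite_of_card_ne_zero (by rw [hSub]; exact hp.out.ne_zero)
  have hnt : Nontrivial Φ.Sub := by
    rw [← Finite.one_lt_card_iff_nontrivial, hSub]
    exact hp.out.one_lt
  obtain ⟨x, hx⟩ := exists_ne (0 : Φ.Sub)
  exact ⟨τ, hτ, x, fun h ↦ hx (eq_zero_of_smul_eq_of_hom θsub hθsub j₁ hj₁ hj₁inj hne h)⟩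

/-- **Orientation (ω, 𝟙) at a SPLIT multiplicative prime.** `W/ℚ` globally minimal with SPLIT multiplicative reduction at `p`, `K`
imaginary quadratic with `(p)` split, `v̄ ∋ p`; `Φ` a `Γ_K`-stable line of `E_K[p]` (`#Φ = p`) embedded equivariantly in `(F/𝒪)(θsub)`
(`θsub^{p−1} = 1`). IF some `τ ∈ D_v̄` has `θsub(τ) ≠ 1`, THEN `#(E_K[p]/Φ) = p`, `D_v̄` acts on `Φ` through the mod-`p` cyclotomic
character and TRIVIALLY on `E_K[p]/Φ` («`(θsub, θquot)|_{G_v̄} = (ω, 𝟙)`»: `Φ|_{D_v̄}` is the Tate line `μ_p`). g9's dichotomy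
`localData_of_split` with the branch «`D_v̄` fixes `Φ` pointwise» excluded by §1's mover.
[cite: GreenbergVatsal2000, §2 pp. 14–15] [cite: KellerYin2024, §1.3 Prop. 1.3.1, §1.4 (arXiv:2402.12781v2 TeX L1066–1083)] -/
theorem trivQuot_and_cycSub_of_exists_unitChar_ne_one
    (hsplitred : W.HasSplitMultiplicativeReductionAtPrime p) (hK : IsImaginaryQuadratic K)
    (hsplit : ((Ideal.span {(p : ℤ)}).primesOver (𝓞 K)).ncard = 2) (hvbar : ((p : ℕ) : 𝓞 K) ∈ vbar.asIdeal)
    (θsub : FramedGaloisRep K (padicCoeffIntegers (∅ : Set (PadicAlgCl p))) 1)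
    (hθsub : ∀ σ : absoluteGaloisGroup K, θsub σ ^ (p - 1) = 1)
    (Φ : StableSubgroup (absoluteGaloisGroup K) ↥((W.baseChange K).geomTorsion (p : ℤ)))
    (hSub : Nat.card Φ.Sub = p) (j₁ : Φ.Sub →+ charModule (∅ : Set (PadicAlgCl p)) θsub)
    (hj₁ : ∀ (g : absoluteGaloisGroup K) (a : Φ.Sub), j₁ (g • a) = g • j₁ a) (hj₁inj : Function.Injective j₁)
    (hram : ∃ τ ∈ decomp vbar, unitChar θsub τ ≠ 1) :
    Nat.card Φ.Quot = p ∧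
      (∀ g ∈ decomp vbar, ∀ x : Φ.Sub, g • x = ((modNCyclotomicCharacter K p g : (ZMod p)ˣ) : ZMod p).val • x) ∧
      (∀ g ∈ decomp vbar, ∀ y : Φ.Quot, g • y = y) := by
  have hp' : ((p : ℕ) : ℤ) = (p : ℤ) := rfl
  obtain ⟨hQuot, hcases⟩ :=
    ResidualDevissageSplitLocalData.localData_of_split (p := p) W K vbar hsplitred hK hsplit hvbar Φ hSub
  refine ⟨hQuot, ?_⟩
  rcases hcases with ⟨hfix, -⟩ | ⟨hcyc, hquot⟩
  · exfalso
    obtain ⟨τ, hτ, x, hx⟩ := exists_smul_ne_of_exists_unitChar_ne_one W K vbar θsub hθsub Φ hSub j₁ hj₁ hj₁inj hram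
    exact hx (hfix τ hτ x)
  · exact ⟨hcyc, hquot⟩

end Orientation

/-! ## §2. The three local `H⁰` conjuncts at `ker κ ⊓ D_v̄` for a split multiplicative `v̄` -/

section Local

variable {p : ℕ} [hp : Fact p.Prime] (W : WeierstrassCurve ℚ) [W.IsElliptic] [W.IsGloballyMinimal]
  (K : Type) [Field K] [NumberField K] (vbar : HeightOneSpectrum (𝓞 K)) (κ : ZpExtension K p)

/-- **`htrivD` at a split multiplicative `v̄`, orientation (ω, 𝟙)**: the local tower group `ker κ ⊓ D_v̄` (indeed all of `D_v̄`) acts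
trivially on `E_K[p]/Φ` — V21 step (5): `N_1^{G_j} = N_1 = 𝔽`. For EVERY `ℤ_p`-extension `κ`.
[cite: KellerYin2024, §1.4 (arXiv:2402.12781v2 TeX L1066–1083, L1240–1260)] [cite: GreenbergVatsal2000, §2 pp. 14–15] -/
theorem forall_inf_decomp_smul_quot_eq_self_of_split
    (hsplitred : W.HasSplitMultiplicativeReductionAtPrime p) (hK : IsImaginaryQuadratic K)
    (hsplit : ((Ideal.span {(p : ℤ)}).primesOver (𝓞 K)).ncard = 2) (hvbar : ((p : ℕ) : 𝓞 K) ∈ vbar.asIdeal)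
    (θsub : FramedGaloisRep K (padicCoeffIntegers (∅ : Set (PadicAlgCl p))) 1)
    (hθsub : ∀ σ : absoluteGaloisGroup K, θsub σ ^ (p - 1) = 1)
    (Φ : StableSubgroup (absoluteGaloisGroup K) ↥((W.baseChange K).geomTorsion (p : ℤ)))
    (hSub : Nat.card Φ.Sub = p) (j₁ : Φ.Sub →+ charModule (∅ : Set (PadicAlgCl p)) θsub)
    (hj₁ : ∀ (g : absoluteGaloisGroup K) (a : Φ.Sub), j₁ (g • a) = g • j₁ a) (hj₁inj : Function.Injective j₁)
    (hram : ∃ τ ∈ decomp vbar, unitChar θsub τ ≠ 1) :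
    ∀ (g : ↥(κ.kerSubgroup ⊓ decomp vbar)) (n : Φ.Quot), g • n = n := fun g n ↦
  (trivQuot_and_cycSub_of_exists_unitChar_ne_one W K vbar hsplitred hK hsplit hvbar θsub hθsub Φ hSub j₁ hj₁ hj₁inj
    hram).2.2 _ (Subgroup.mem_inf.mp g.2).2 n

omit [W.IsElliptic] [W.IsGloballyMinimal] in
/-- **`hN₁D` at a split multiplicative `v̄`, orientation (ω, 𝟙): `Φ^{ker κ ⊓ D_v̄} = 0`** for EVERY `ℤ_p`-extension `κ`: the line
`Φ = 𝔽(ω̃)` is moved by some `τ ∈ D_v̄` (§1), hence has no non-zero point fixed by `D_v̄ ⊓ ker κ` (`p`-power descent on the line,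
`AnomalousLocalTorsion.eq_zero_of_mem_line_of_fixed`) — V21 step (5): `N_ω^{G_j} = 0` («`μ_p ⊄ K_{∞,w}`»).
[cite: KellerYin2024, §1.3 (arXiv:2402.12781v2 TeX L944–946, L1043)] [cite: GreenbergLNM1716, §4 proof of Prop. 4.8 (p. 109)] -/
theorem sub_eq_zero_of_forall_inf_decomp_smul_eq_of_split
    (θsub : FramedGaloisRep K (padicCoeffIntegers (∅ : Set (PadicAlgCl p))) 1)
    (hθsub : ∀ σ : absoluteGaloisGroup K, θsub σ ^ (p - 1) = 1)
    (Φ : StableSubgroup (absoluteGaloisGroup K) ↥((W.baseChange K).geomTorsion (p : ℤ)))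
    (hSub : Nat.card Φ.Sub = p) (j₁ : Φ.Sub →+ charModule (∅ : Set (PadicAlgCl p)) θsub)
    (hj₁ : ∀ (g : absoluteGaloisGroup K) (a : Φ.Sub), j₁ (g • a) = g • j₁ a) (hj₁inj : Function.Injective j₁)
    (hram : ∃ τ ∈ decomp vbar, unitChar θsub τ ≠ 1) :
    ∀ n : Φ.Sub, (∀ g : ↥(κ.kerSubgroup ⊓ decomp vbar), g • n = n) → n = 0 := by
  intro n hn
  obtain ⟨τ, hτ, x, hx⟩ := exists_smul_ne_of_exists_unitChar_ne_one W K vbar θsub hθsub Φ hSub j₁ hj₁ hj₁inj hram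
  -- the line inside the discrete `Γ_K`-module `E_K[p]`
  have hcont : ∀ m : ↥((W.baseChange K).geomTorsion (p : ℤ)), Continuous fun g : absoluteGaloisGroup K ↦ g • m :=
    fun m ↦ continuous_of_injective_comp (ι := fun x : ↥((W.baseChange K).geomTorsion (p : ℤ)) ↦
      (x : geomPoints (W.baseChange K))) Subtype.val_injective
      ((W.baseChange K).continuous_smul_geomPoints (m : geomPoints (W.baseChange K)))
  have hmove : ∃ P ∈ Φ.toAddSubgroup, τ • P ≠ P :=
    ⟨Φ.incl x, by rw [← Φ.range_incl]; exact ⟨x, rfl⟩, fun h ↦ hx (Φ.incl_injective (by rw [Φ.incl_smul]; exact h))⟩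
  have h0 := AnomalousLocalTorsion.eq_zero_of_mem_line_of_fixed κ (decomp vbar) (AnomalousLocalTorsion.isClosed_decomp vbar)
    hcont Φ.toAddSubgroup hSub hτ (fun R hR ↦ Φ.smul_mem' τ hR) hmove
    (P := Φ.incl n) (by rw [← Φ.range_incl]; exact ⟨n, rfl⟩) (fun g hg ↦ by
      obtain ⟨hgD, hgk⟩ := Subgroup.mem_inf.mp hg
      have := hn ⟨g, Subgroup.mem_inf.mpr ⟨hgk, hgD⟩⟩
      rw [← Φ.incl_smul]
      exact congrArg Φ.incl this)
  exact Φ.incl_injective (by rw [h0, map_zero])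

/-- **`[Finite A₂^{H ⊓ D_𝔭}]` at a SPLIT multiplicative `v̄`**: `{x ∈ E_K[p^∞] : (ker κ ⊓ D_v̄) x = x} = E(K_{∞,v̄})[p^∞]` is FINITE on the
anticyclotomic tower — k5-c4's Fin_v `CtlLoc.localTowerTorsionFiniteAt_of_hasSplitMultiplicativeReductionAtPrime` (Tate uniformisation of
`E_K` at `v̄`, the Tate line with trivial quotient action, the norm residue symbol of `π²/p^h` moving it), read in the subtype currency
of the x1 stub. [cite: JetchevSkinnerWan2017, §3.3 Prop. 3.3.4 Case 3(b) (arXiv:1512.06894 p. 13)] [cite: GreenbergVatsal2000, §2 pp. 14–15]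
[cite: KellerYin2024, §1.3 Prop. 1.3.3 (iii) (arXiv:2402.12781v2 TeX L948–957)] -/
theorem finite_fixed_geomPrimaryTorsion_inf_decomp_of_split (hp2 : p ≠ 2)
    (hsplitred : W.HasSplitMultiplicativeReductionAtPrime p) (hK : IsImaginaryQuadratic K)
    (hsplit : ((Ideal.span {(p : ℤ)}).primesOver (𝓞 K)).ncard = 2) (hvbar : ((p : ℕ) : 𝓞 K) ∈ vbar.asIdeal)
    (hκ : κ.IsAnticyclotomic) :
    Finite {x : ↥((W.baseChange K).geomPrimaryTorsion p) // ∀ g : ↥(κ.kerSubgroup ⊓ decomp vbar), g • x = x} := by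
  have hfin := CtlLoc.localTowerTorsionFiniteAt_of_hasSplitMultiplicativeReductionAtPrime (W := W) (K := K) hp2 hsplitred hK
    hsplit κ hκ vbar hvbar
  unfold LocalTowerTorsionFiniteAt at hfin
  haveI := hfin.to_subtype
  refine Finite.of_injective (fun x ↦ (⟨x.1, (FixedPoints.mem_addSubgroup _ _ _).mpr fun g ↦
    x.2 ⟨g.1, Subgroup.mem_inf.mpr (Subgroup.mem_inf.mp g.2).symm⟩⟩ :
      ↥(FixedPoints.addSubgroup ↥(decomp vbar ⊓ κ.kerSubgroup) ((W.baseChange K).geomPrimaryTorsion p)))) fun a b hab ↦ ?_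
  have h := congrArg Subtype.val hab
  exact Subtype.ext h

end Local

/-! ## §3. The thirteen-conjunct `H⁰` package of the index road at a split multiplicative datum -/

section Package

/-- **THE `H⁰` PACKAGE OF THE V21 INDEX ROAD AT A SPLIT MULTIPLICATIVE DATUM, orientation (ω, 𝟙)** — the conjuncts «global H⁰» and
«local H⁰ at `H ⊓ D_v̄`» of x1's `stub_indexInputs` in x1's ORDER AND TYPES (cf. `ResidualIndexHZero.hZero_package`): on the binders
`p ≠ 2` SPLIT multiplicative for `W`, `K` imaginary quadratic with `(p)` split, `E(K)[p] = 0`, `v̄ ∋ p`, `κ` anticyclotomic, `(θsub, θquot)`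
a residual pair of `E_K[p]`, for ANY `Γ_K`-stable line `Φ` of `E_K[p]` (`StableSubgroup`, `#Φ = #(E_K[p]/Φ) = p`) with equivariant
embeddings `j₁ : Φ ↪ (F/𝒪)(θsub)`, `j₃ : E_K[p]/Φ ↪ (F/𝒪)(θquot)`, and GIVEN a `τ ∈ D_v̄` with `θsub(τ) ≠ 1` (orientation): (1)–(3) the
`ker κ`-invariants of `(F/𝒪)(θsub)`, `E_K[p^∞]`, `(F/𝒪)(θquot)` are `p`-divisible in themselves; (4) `E_K[p]^{ker κ} = 0`; (5)–(6)
`(E_K[p]/Φ)^{ker κ}` finite of order `p^ε`, `ε = [θquot = 𝟙]`; (7) `Φ^{ker κ ⊓ D_v̄} = 0`; (8) `ker κ ⊓ D_v̄` trivial on `E_K[p]/Φ`; (9)–(10)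
`E_K[p]/Φ` finite of order `p`; (11) `E_K[p^∞]^{ker κ ⊓ D_v̄}` finite; (12)–(13) the `ker κ ⊓ D_v̄`-invariants of `(F/𝒪)(θsub)`, `(F/𝒪)(θquot)`
divisible in themselves. (1)–(6), (9)–(10), (12)–(13) by x1's reduction-free producers; (7), (8), (11) by §2.
[cite: KellerYin2024, §1.3 Prop. 1.3.3 (iii), §1.4 Thm. 1.4.1 and Cases I–III (arXiv:2402.12781v2 TeX L948–957, L1066–1098, L1178–1330)]
[cite: GreenbergVatsal2000, §2 pp. 14–15] [cite: GreenbergLNM1716, §1 p. 62, §4 p. 109] -/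
theorem hZero_package_of_split (W : WeierstrassCurve ℚ) [W.IsElliptic] [W.IsGloballyMinimal] (p : ℕ) [Fact p.Prime]
    (hp2 : p ≠ 2) (hsplitred : W.HasSplitMultiplicativeReductionAtPrime p)
    (K : Type) [Field K] [NumberField K] (hK : IsImaginaryQuadratic K)
    (hsplit : ((Ideal.span {(p : ℤ)}).primesOver (𝓞 K)).ncard = 2)
    (htor : ∀ Q : (W.baseChange K).toAffine.Point, p • Q = 0 → Q = 0)
    (vbar : HeightOneSpectrum (𝓞 K)) (hvbar : ((p : ℕ) : 𝓞 K) ∈ vbar.asIdeal)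
    (κ : ZpExtension K p) (hκ : κ.IsAnticyclotomic)
    (θsub θquot : FramedGaloisRep K (padicCoeffIntegers (∅ : Set (PadicAlgCl p))) 1)
    (hpair : IsResidualPairOver (W.baseChange K) p θsub θquot)
    (hram : ∃ τ ∈ decomp vbar, unitChar θsub τ ≠ 1)
    (Φ : StableSubgroup (absoluteGaloisGroup K) ↥((W.baseChange K).geomTorsion (p : ℤ)))
    (hSub : Nat.card Φ.Sub = p) (hQuot : Nat.card Φ.Quot = p)
    (j₁ : Φ.Sub →+ charModule ∅ θsub)
    (hj₁ : ∀ (g : absoluteGaloisGroup K) (a : Φ.Sub), j₁ (g • a) = g • j₁ a) (hj₁inj : Function.Injective j₁)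
    (j₃ : Φ.Quot →+ charModule ∅ θquot)
    (hj₃ : ∀ (g : absoluteGaloisGroup K) (a : Φ.Quot), j₃ (g • a) = g • j₃ a) (hj₃inj : Function.Injective j₃) :
    -- global H⁰
    (∀ x : (charModule ∅ θsub), (∀ g : ↥κ.kerSubgroup, g • x = x) → ∃ x' : (charModule ∅ θsub), (∀ g : ↥κ.kerSubgroup, g • x' = x') ∧ p • x' = x) ∧
    (∀ x : ↥((W.baseChange K).geomPrimaryTorsion p), (∀ g : ↥κ.kerSubgroup, g • x = x) → ∃ x' : ↥((W.baseChange K).geomPrimaryTorsion p), (∀ g : ↥κ.kerSubgroup, g • x' = x') ∧ p • x' = x) ∧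
    (∀ x : (charModule ∅ θquot), (∀ g : ↥κ.kerSubgroup, g • x = x) → ∃ x' : (charModule ∅ θquot), (∀ g : ↥κ.kerSubgroup, g • x' = x') ∧ p • x' = x) ∧
    (∀ n : ↥((W.baseChange K).geomTorsion (p : ℤ)), (∀ g : ↥κ.kerSubgroup, g • n = n) → n = 0) ∧
    Finite {n : Φ.Quot // ∀ g : ↥κ.kerSubgroup, g • n = n} ∧
    Nat.card {n : Φ.Quot // ∀ g : ↥κ.kerSubgroup, g • n = n} = p ^ (if ∀ σ : absoluteGaloisGroup K, θquot σ = 1 then 1 else 0) ∧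
    -- local H⁰ at `H ⊓ D_v̄`
    (∀ n : Φ.Sub, (∀ g : ↥(κ.kerSubgroup ⊓ decomp vbar), g • n = n) → n = 0) ∧
    (∀ (g : ↥(κ.kerSubgroup ⊓ decomp vbar)) (n : Φ.Quot), g • n = n) ∧
    Finite Φ.Quot ∧ Nat.card Φ.Quot = p ∧
    Finite {x : ↥((W.baseChange K).geomPrimaryTorsion p) // ∀ g : ↥(κ.kerSubgroup ⊓ decomp vbar), g • x = x} ∧
    (∀ x : (charModule ∅ θsub), (∀ g : ↥(κ.kerSubgroup ⊓ decomp vbar), g • x = x) → ∃ x' : (charModule ∅ θsub), (∀ g : ↥(κ.kerSubgroup ⊓ decomp vbar), g • x' = x') ∧ p • x' = x) ∧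
    (∀ x : (charModule ∅ θquot), (∀ g : ↥(κ.kerSubgroup ⊓ decomp vbar), g • x = x) → ∃ x' : (charModule ∅ θquot), (∀ g : ↥(κ.kerSubgroup ⊓ decomp vbar), g • x' = x') ∧ p • x' = x) := by
  have hpr : p.Prime := Fact.out
  have hθsub : ∀ σ : absoluteGaloisGroup K, θsub σ ^ (p - 1) = 1 := fun σ ↦ (hpair.pow_sub_one σ).1
  have hθquot : ∀ σ : absoluteGaloisGroup K, θquot σ ^ (p - 1) = 1 := fun σ ↦ (hpair.pow_sub_one σ).2
  haveI : Finite Φ.Quot := Nat.finite_of_card_ne_zero (by rw [hQuot]; exact hpr.ne_zero)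
  exact ⟨ResidualIndexHZero.charModule_subgroup_invariants_divisible θsub hθsub κ.kerSubgroup,
    ResidualIndexHZero.geomPrimaryTorsion_kerSubgroup_invariants_divisible κ (W.baseChange K) htor,
    ResidualIndexHZero.charModule_subgroup_invariants_divisible θquot hθquot κ.kerSubgroup,
    ResidualIndexHZero.geomTorsion_eq_zero_of_forall_kerSubgroup_smul_eq κ (W.baseChange K) htor,
    inferInstance,
    ResidualIndexHZero.natCard_fixed_kerSubgroup_eq θquot κ hθquot hQuot j₃ hj₃ hj₃inj,
    sub_eq_zero_of_forall_inf_decomp_smul_eq_of_split W K vbar κ θsub hθsub Φ hSub j₁ hj₁ hj₁inj hram,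
    forall_inf_decomp_smul_quot_eq_self_of_split W K vbar κ hsplitred hK hsplit hvbar θsub hθsub Φ hSub j₁ hj₁ hj₁inj hram,
    inferInstance, hQuot,
    finite_fixed_geomPrimaryTorsion_inf_decomp_of_split W K vbar κ hp2 hsplitred hK hsplit hvbar hκ,
    ResidualIndexHZero.charModule_subgroup_invariants_divisible θsub hθsub _,
    ResidualIndexHZero.charModule_subgroup_invariants_divisible θquot hθquot _⟩

/-- **The package from the residual pair alone, split multiplicative datum, orientation (ω, 𝟙)**: `IsResidualPairOver` yields the stable line
`Φ` with `#Φ = #(E_K[p]/Φ) = p` and both Kummer embeddings (`ResidualPairStableLine.exists_stableLine_of_isResidualPairOver`), for which the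
thirteen `H⁰` conjuncts hold (the split twin of x1's `ResidualIndexHZero.exists_stableLine_hZero_package`).
[cite: KellerYin2024, §1.4 (arXiv:2402.12781v2 TeX L1063–1098)] [cite: GreenbergVatsal2000, §2 pp. 14–15] -/
theorem exists_stableLine_hZero_package_of_split (W : WeierstrassCurve ℚ) [W.IsElliptic] [W.IsGloballyMinimal] (p : ℕ)
    [Fact p.Prime] (hp2 : p ≠ 2) (hsplitred : W.HasSplitMultiplicativeReductionAtPrime p)
    (K : Type) [Field K] [NumberField K] (hK : IsImaginaryQuadratic K)
    (hsplit : ((Ideal.span {(p : ℤ)}).primesOver (𝓞 K)).ncard = 2)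
    (htor : ∀ Q : (W.baseChange K).toAffine.Point, p • Q = 0 → Q = 0)
    (vbar : HeightOneSpectrum (𝓞 K)) (hvbar : ((p : ℕ) : 𝓞 K) ∈ vbar.asIdeal)
    (κ : ZpExtension K p) (hκ : κ.IsAnticyclotomic)
    (θsub θquot : FramedGaloisRep K (padicCoeffIntegers (∅ : Set (PadicAlgCl p))) 1)
    (hpair : IsResidualPairOver (W.baseChange K) p θsub θquot)
    (hram : ∃ τ ∈ decomp vbar, unitChar θsub τ ≠ 1) :
    ∃ (Φ : StableSubgroup (absoluteGaloisGroup K) ↥((W.baseChange K).geomTorsion (p : ℤ)))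
      (j₁ : Φ.Sub →+ charModule ∅ θsub) (j₃ : Φ.Quot →+ charModule ∅ θquot),
      (∀ (g : absoluteGaloisGroup K) (a : Φ.Sub), j₁ (g • a) = g • j₁ a) ∧
      (∀ (g : absoluteGaloisGroup K) (a : Φ.Quot), j₃ (g • a) = g • j₃ a) ∧
      Function.Injective j₁ ∧ Function.Injective j₃ ∧
      (∀ x : charModule ∅ θsub, x ∈ j₁.range ↔ p • x = 0) ∧ (∀ x : charModule ∅ θquot, x ∈ j₃.range ↔ p • x = 0) ∧
      Nat.card Φ.Sub = p ∧
      (∀ x : (charModule ∅ θsub), (∀ g : ↥κ.kerSubgroup, g • x = x) → ∃ x' : (charModule ∅ θsub), (∀ g : ↥κ.kerSubgroup, g • x' = x') ∧ p • x' = x) ∧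
      (∀ x : ↥((W.baseChange K).geomPrimaryTorsion p), (∀ g : ↥κ.kerSubgroup, g • x = x) → ∃ x' : ↥((W.baseChange K).geomPrimaryTorsion p), (∀ g : ↥κ.kerSubgroup, g • x' = x') ∧ p • x' = x) ∧
      (∀ x : (charModule ∅ θquot), (∀ g : ↥κ.kerSubgroup, g • x = x) → ∃ x' : (charModule ∅ θquot), (∀ g : ↥κ.kerSubgroup, g • x' = x') ∧ p • x' = x) ∧
      (∀ n : ↥((W.baseChange K).geomTorsion (p : ℤ)), (∀ g : ↥κ.kerSubgroup, g • n = n) → n = 0) ∧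
      Finite {n : Φ.Quot // ∀ g : ↥κ.kerSubgroup, g • n = n} ∧
      Nat.card {n : Φ.Quot // ∀ g : ↥κ.kerSubgroup, g • n = n} = p ^ (if ∀ σ : absoluteGaloisGroup K, θquot σ = 1 then 1 else 0) ∧
      (∀ n : Φ.Sub, (∀ g : ↥(κ.kerSubgroup ⊓ decomp vbar), g • n = n) → n = 0) ∧
      (∀ (g : ↥(κ.kerSubgroup ⊓ decomp vbar)) (n : Φ.Quot), g • n = n) ∧
      Finite Φ.Quot ∧ Nat.card Φ.Quot = p ∧
      Finite {x : ↥((W.baseChange K).geomPrimaryTorsion p) // ∀ g : ↥(κ.kerSubgroup ⊓ decomp vbar), g • x = x} ∧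
      (∀ x : (charModule ∅ θsub), (∀ g : ↥(κ.kerSubgroup ⊓ decomp vbar), g • x = x) → ∃ x' : (charModule ∅ θsub), (∀ g : ↥(κ.kerSubgroup ⊓ decomp vbar), g • x' = x') ∧ p • x' = x) ∧
      (∀ x : (charModule ∅ θquot), (∀ g : ↥(κ.kerSubgroup ⊓ decomp vbar), g • x = x) → ∃ x' : (charModule ∅ θquot), (∀ g : ↥(κ.kerSubgroup ⊓ decomp vbar), g • x' = x') ∧ p • x' = x) := by
  haveI hEK : (W.baseChange K).IsElliptic := inferInstanceAs (W.map (algebraMap ℚ K)).IsElliptic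
  obtain ⟨Φ, hSub, hQuot, ⟨j₁, hj₁, hj₁inj, hr₁⟩, ⟨j₃, hj₃, hj₃inj, hr₃⟩⟩ :=
    ResidualPairStableLine.exists_stableLine_of_isResidualPairOver (W.baseChange K) hpair
  exact ⟨Φ, j₁, j₃, hj₁, hj₃, hj₁inj, hj₃inj, hr₁, hr₃, hSub, hZero_package_of_split W p hp2 hsplitred K hK hsplit htor vbar hvbar κ hκ
    θsub θquot hpair hram Φ hSub hQuot j₁ hj₁ hj₁inj j₃ hj₃ hj₃inj⟩

end Package

end Summit.BirchSwinnertonDyer.BirchSwinnertonDyer.Theorems.SplitMultLocalHZero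

end
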